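import Literature.MathematicalPhysics.KineticTheory.HardSphereEulerProofs
import HarnessLib

/-!
# Exact `L²` tilt statics for local Gibbs laws
# (`SmallDataRingSparsity`, stmt-AtomisticToContinuum-12132, route `RingDensityCertificate`; file 1 of 2)

Helper file (`--supports stmt-AtomisticToContinuum-12132`): the static half of the quantitative
Cauchy–Schwarz tilt `P_N(B) ≤ e^{Λ(N+1)} Q_N(B)^{1/2}` (hypothesis (2) of
`SmallDataRingSparsity.smallDataRingSparsity_hFirst_of`), made EXACT rather than by Gaussian
domination (Kipnis–Landim 1999, App. 1 §8: the `L²` norm of the density of a local equilibrium with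
respect to the homogeneous state):

* `sq_mul_localMaxwellian_eq`, `localGibbsProfile_sq_eq` — the one-body identity
  `(a₀ M_{1,u₀,θ₀})² = ã M_{1,ũ,θ̃} · M_{1,0,θc}` with the TILTED profile
  `ã = a₀² (θc²/(θ₀(2θc-θ₀)))^{3/2} e^{‖u₀‖²/(2θc-θ₀)}`, `ũ = 2θc u₀/(2θc-θ₀)`, `θ̃ = θ₀θc/(2θc-θ₀)`
  (`0 < θ₀ < 2θc`; complete the square: `exponent_identity`, `rpow_prefactor_identity`);
* `indicator_tensorPow_sq_le_mul`, `inv_mul_le_sqrt_mul_sqrt`, `lintegral_indicator_tensorPow_eq` —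
  tensorisation on the hard-sphere domain, the pointwise Cauchy–Schwarz splitting of the canonical
  densities, and `∫ 𝟙_D f^{⊗n} = Z_pos[a₀]` (velocities integrate to one, `lintegral_gibbsWeight_mul`);
* `localGibbsLaw_le_sqrt_mul_rpow_half` — the static transfer: if `f_P² ≤ f_R f_Q` pointwise then
  `P_N(B) ≤ √(Z_pos[1] Z_pos[a_R]/Z_pos[a₀]²) · Q_N(B)^{1/2}` for every measurable `B` (Hölder `(2,2)`).

The amplitude choice and the final quantitative statement are in
`RingDensityCertificateSmallDataRingSparsityQuantTilt.lean`. No flow invariance is used (time `0`).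

References: C. Kipnis, C. Landim, *Scaling Limits of Interacting Particle Systems* (1999), App. 1 §8,
Ch. 10; H. Spohn, *Large Scale Dynamics of Interacting Particles* (1991), Part I §2.3.
-/

noncomputable section

namespace Summit.AtomisticToContinuum.HydrodynamicLimit.Theorems

namespace SmallDataRingSparsity

open MeasureTheory Filter Set Topology Real
open scoped ENNReal
open Literature.Analysis.FluidPDE Literature.MathematicalPhysics.KineticTheory

/-! ### One-body algebra: the exact Gaussian identity `f_P² = f_R · f_Q` -/

/-- The normalising constants: for `0 < θ < 2θc` and `d : ℕ`,
`((2πθ)^{-d/2})² = (θc²/(θ(2θc-θ)))^{d/2} · (2π θθc/(2θc-θ))^{-d/2} · (2πθc)^{-d/2}`. [folklore] -/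
theorem rpow_prefactor_identity {θ θc : ℝ} (hθ : 0 < θ) (h2 : θ < 2 * θc) (d : ℕ) :
    ((2 * π * θ) ^ (-(d : ℝ) / 2)) ^ 2 =
      (θc ^ 2 / (θ * (2 * θc - θ))) ^ ((d : ℝ) / 2) *
        (2 * π * (θ * θc / (2 * θc - θ))) ^ (-(d : ℝ) / 2) * (2 * π * θc) ^ (-(d : ℝ) / 2) := by
  have hgap : 0 < 2 * θc - θ := by linarith
  have hθc : 0 < θc := by linarith
  have hπ : 0 < π := Real.pi_pos
  have hA : 0 < 2 * π * θ := by positivity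
  have hY : 0 < 2 * π * (θ * θc / (2 * θc - θ)) := by positivity
  have hZ : 0 < 2 * π * θc := by positivity
  have hX : 0 ≤ θc ^ 2 / (θ * (2 * θc - θ)) := by positivity
  have hneg : ∀ {x : ℝ}, 0 < x → x ^ (-(d : ℝ) / 2) = x⁻¹ ^ ((d : ℝ) / 2) := by
    intro x hx
    rw [neg_div, Real.rpow_neg hx.le, Real.inv_rpow hx.le]
  rw [hneg hA, hneg hY, hneg hZ, ← Real.rpow_natCast, ← Real.rpow_mul (inv_nonneg.2 hA.le),
    ← Real.mul_rpow hX (inv_nonneg.2 hY.le), ← Real.mul_rpow (by positivity) (inv_nonneg.2 hZ.le)]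
  have h2 : ((d : ℝ) / 2 * (2 : ℕ)) = (d : ℝ) := by push_cast; ring
  rw [h2]
  have hθne : θ ≠ 0 := hθ.ne'
  have hgapne : 2 * θc - θ ≠ 0 := hgap.ne'
  have hgapne' : θc * 2 - θ ≠ 0 := by rw [mul_comm]; exact hgapne
  have hθcne : θc ≠ 0 := hθc.ne'
  have hπne : π ≠ 0 := hπ.ne'
  have hbase : θc ^ 2 / (θ * (2 * θc - θ)) * (2 * π * (θ * θc / (2 * θc - θ)))⁻¹ * (2 * π * θc)⁻¹ =
      ((2 * π * θ)⁻¹) ^ (2 : ℕ) := by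
    field_simp
  rw [hbase, ← Real.rpow_natCast ((2 * π * θ)⁻¹) 2, ← Real.rpow_mul (inv_nonneg.2 hA.le)]
  congr 1
  push_cast
  ring

/-- The exponents: for `θ ≠ 0`, `2θc - θ ≠ 0`, `θc ≠ 0`,
`-‖v-u‖²/(2θ) - ‖v-u‖²/(2θ) = ‖u‖²/(2θc-θ) - ‖v - βu‖²/(2θ*) - ‖v‖²/(2θc)` with
`β = 2θc/(2θc-θ)`, `θ* = θθc/(2θc-θ)` (complete the square). [folklore] -/
theorem exponent_identity {θ θc : ℝ} (hθ : θ ≠ 0) (hgap : 2 * θc - θ ≠ 0) (hθc : θc ≠ 0)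
    (u v : V3) :
    -‖v - u‖ ^ 2 / (2 * θ) + -‖v - u‖ ^ 2 / (2 * θ) =
      ‖u‖ ^ 2 / (2 * θc - θ) +
        -‖v - (2 * θc / (2 * θc - θ)) • u‖ ^ 2 / (2 * (θ * θc / (2 * θc - θ))) +
          -‖v‖ ^ 2 / (2 * θc) := by
  have h1 : ‖v - u‖ ^ 2 = ‖v‖ ^ 2 - 2 * inner ℝ v u + ‖u‖ ^ 2 := norm_sub_sq_real v u
  have h2 : ‖v - (2 * θc / (2 * θc - θ)) • u‖ ^ 2 =
      ‖v‖ ^ 2 - 2 * ((2 * θc / (2 * θc - θ)) * inner ℝ v u) +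
        (2 * θc / (2 * θc - θ)) ^ 2 * ‖u‖ ^ 2 := by
    rw [norm_sub_sq_real, inner_smul_right, norm_smul, Real.norm_eq_abs, mul_pow, sq_abs]
  rw [h1, h2]
  field_simp
  ring

/-- **The exact one-body identity.** For `0 < θ < 2θc`,
`(a M_{1,u,θ}(v))² = (a² m) · M_{1, βu, θ*}(v) · M_{1,0,θc}(v)` with
`m = (θc²/(θ(2θc-θ)))^{d/2} e^{‖u‖²/(2θc-θ)}`, `β = 2θc/(2θc-θ)`, `θ* = θθc/(2θc-θ)`: the square of
a local Maxwellian divided by the reference Maxwellian `M_{1,0,θc}` is again a (normalised) local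
Maxwellian times the explicit factor `m`, whose `v`-integral is therefore exactly `a² m`.
[folklore] -/
theorem sq_mul_localMaxwellian_eq {a θ θc : ℝ} (hθ : 0 < θ) (h2 : θ < 2 * θc) (u v : V3) :
    (a * localMaxwellian 1 θ u v) ^ 2 =
      (a ^ 2 * ((θc ^ 2 / (θ * (2 * θc - θ))) ^ ((Module.finrank ℝ V3 : ℝ) / 2) *
          Real.exp (‖u‖ ^ 2 / (2 * θc - θ)))) *
        localMaxwellian 1 (θ * θc / (2 * θc - θ)) ((2 * θc / (2 * θc - θ)) • u) v *
          localMaxwellian 1 θc (0 : V3) v := by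
  have hgap : 0 < 2 * θc - θ := by linarith
  have hθc : 0 < θc := by linarith
  have hexp : Real.exp (-‖v - u‖ ^ 2 / (2 * θ)) ^ 2 =
      Real.exp (‖u‖ ^ 2 / (2 * θc - θ)) *
        Real.exp (-‖v - (2 * θc / (2 * θc - θ)) • u‖ ^ 2 / (2 * (θ * θc / (2 * θc - θ)))) *
          Real.exp (-‖v - 0‖ ^ 2 / (2 * θc)) := by
    rw [sub_zero, sq, ← Real.exp_add, ← Real.exp_add, ← Real.exp_add,
      exponent_identity hθ.ne' hgap.ne' hθc.ne' u v]
  have hpre := rpow_prefactor_identity hθ h2 (Module.finrank ℝ V3)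
  simp only [localMaxwellian, one_mul]
  calc (a * ((2 * π * θ) ^ (-(Module.finrank ℝ V3 : ℝ) / 2) * Real.exp (-‖v - u‖ ^ 2 / (2 * θ)))) ^ 2
      = a ^ 2 * ((2 * π * θ) ^ (-(Module.finrank ℝ V3 : ℝ) / 2)) ^ 2 *
          Real.exp (-‖v - u‖ ^ 2 / (2 * θ)) ^ 2 := by ring
    _ = a ^ 2 * ((θc ^ 2 / (θ * (2 * θc - θ))) ^ ((Module.finrank ℝ V3 : ℝ) / 2) *
          (2 * π * (θ * θc / (2 * θc - θ))) ^ (-(Module.finrank ℝ V3 : ℝ) / 2) *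
            (2 * π * θc) ^ (-(Module.finrank ℝ V3 : ℝ) / 2)) *
          (Real.exp (‖u‖ ^ 2 / (2 * θc - θ)) *
            Real.exp (-‖v - (2 * θc / (2 * θc - θ)) • u‖ ^ 2 / (2 * (θ * θc / (2 * θc - θ)))) *
              Real.exp (-‖v - 0‖ ^ 2 / (2 * θc))) := by rw [hpre, hexp]
    _ = _ := by ring

/-! ### The tilted one-body profile of `f_P²/f_Q` -/

/-- **Profile form of the identity**: for `0 < θ₀ < 2θc` pointwise,
`f_P(x,v)² = f_R(x,v) · f_Q(x,v)` with `f_P = a₀ M_{1,u₀,θ₀}`, `f_Q = M_{1,0,θc}` and the TILTED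
local Gibbs profile `f_R = ã M_{1,ũ,θ̃}`, `ã = a₀² (θc²/(θ₀(2θc-θ₀)))^{d/2} e^{‖u₀‖²/(2θc-θ₀)}`,
`ũ = (2θc/(2θc-θ₀)) u₀`, `θ̃ = θ₀θc/(2θc-θ₀)`. [folklore] -/
theorem localGibbsProfile_sq_eq {a₀ θ₀ : T3 → ℝ} {u₀ : T3 → V3} {θc : ℝ}
    (hθ0 : ∀ x, 0 < θ₀ x) (hθc : ∀ x, θ₀ x < 2 * θc) (y : T3 × V3) :
    localGibbsProfile a₀ u₀ θ₀ y ^ 2 =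
      localGibbsProfile
          (fun x => a₀ x ^ 2 * ((θc ^ 2 / (θ₀ x * (2 * θc - θ₀ x))) ^ ((Module.finrank ℝ V3 : ℝ) / 2) *
            Real.exp (‖u₀ x‖ ^ 2 / (2 * θc - θ₀ x))))
          (fun x => (2 * θc / (2 * θc - θ₀ x)) • u₀ x) (fun x => θ₀ x * θc / (2 * θc - θ₀ x)) y *
        localGibbsProfile 1 0 (fun _ => θc) y := by
  obtain ⟨x, v⟩ := y
  simp only [localGibbsProfile, Pi.one_apply, Pi.zero_apply, one_mul]
  exact sq_mul_localMaxwellian_eq (hθ0 x) (hθc x) (u₀ x) v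

/-- Tensorisation on the hard-sphere domain: `f_P² ≤ f_R f_Q` pointwise gives
`(𝟙_D f_P^{⊗n})² ≤ (𝟙_D f_R^{⊗n}) (𝟙_D f_Q^{⊗n})`. [folklore] -/
theorem indicator_tensorPow_sq_le_mul {n : ℕ} {fP fQ fR : T3 × V3 → ℝ}
    (hdom : ∀ y, fP y ^ 2 ≤ fR y * fQ y)
    (D : Set (Config n (Fin 3) T3)) (z : Config n (Fin 3) T3) :
    (D.indicator (tensorPow n fP) z) ^ 2 ≤
      D.indicator (tensorPow n fR) z * D.indicator (tensorPow n fQ) z := by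
  by_cases hz : z ∈ D
  · rw [Set.indicator_of_mem hz, Set.indicator_of_mem hz, Set.indicator_of_mem hz]
    simp only [tensorPow]
    calc (∏ i, fP (z i)) ^ 2 = ∏ i, fP (z i) ^ 2 := (Finset.prod_pow _ _ _).symm
      _ ≤ ∏ i, (fR (z i) * fQ (z i)) :=
          Finset.prod_le_prod (fun i _ => sq_nonneg _) (fun i _ => hdom _)
      _ = (∏ i, fR (z i)) * ∏ i, fQ (z i) := Finset.prod_mul_distrib
  · simp [Set.indicator_of_notMem hz]

/-- The real-variable Cauchy–Schwarz splitting: if `iP² ≤ iR · iQ` (all nonnegative) and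
`Z_P, Z_Q > 0` then `Z_P⁻¹ iP ≤ √((Z_Q/Z_P²) iR) · √(Z_Q⁻¹ iQ)`. [folklore] -/
theorem inv_mul_le_sqrt_mul_sqrt {iP iQ iR ZP ZQ : ℝ} (hiP : 0 ≤ iP) (hiQ : 0 ≤ iQ)
    (hiR : 0 ≤ iR) (hZP : 0 < ZP) (hZQ : 0 < ZQ) (h : iP ^ 2 ≤ iR * iQ) :
    ZP⁻¹ * iP ≤ Real.sqrt (ZQ / ZP ^ 2 * iR) * Real.sqrt (ZQ⁻¹ * iQ) := by
  have h0 : 0 ≤ ZQ / ZP ^ 2 * iR := by positivity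
  rw [← Real.sqrt_mul h0]
  refine (Real.le_sqrt (by positivity) (by positivity)).2 ?_
  have hid : ZQ / ZP ^ 2 * iR * (ZQ⁻¹ * iQ) = (ZP⁻¹) ^ 2 * (iR * iQ) := by
    field_simp
  rw [hid, mul_pow]
  exact mul_le_mul_of_nonneg_left h (sq_nonneg _)

/-- The total mass of the hard-sphere-restricted tensor power of a local Gibbs profile is its
configurational partition function `Z_pos[a₀]` (velocities integrate to one). [folklore] -/
theorem lintegral_indicator_tensorPow_eq {a₀ θ₀ : T3 → ℝ} {u₀ : T3 → V3} (ha : Continuous a₀)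
    (hθ : Continuous θ₀) (hu : Continuous u₀) (ha0 : ∀ x, 0 ≤ a₀ x) (hθ0 : ∀ x, 0 < θ₀ x) (ε : ℝ)
    (n : ℕ) :
    ∫⁻ z, ENNReal.ofReal ((hardSphereDomain (Torus.geometry (Fin 3)) n ε).indicator
        (tensorPow n (localGibbsProfile a₀ u₀ θ₀)) z) = ENNReal.ofReal (posPartition a₀ ε n) := by
  have h := lintegral_gibbsWeight_mul ha hθ hu ha0 hθ0 ε n (G := fun _ => 1) measurable_const
  simp only [mul_one, lintegral_const, measure_univ] at h
  rw [h, ofReal_posPartition ha ha0]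

/-! ### The static `L²` transfer (Cauchy–Schwarz against the homogeneous law) -/

/-- **Static Cauchy–Schwarz transfer.** If the one-body profiles satisfy `f_P² ≤ f_R · f_Q`
pointwise (`f_Q = M_{1,0,θc}` the homogeneous profile, `f_R` any continuous local Gibbs profile),
then for every measurable `B` and every particle number,
`P_N(B) ≤ √(Z_pos[1] Z_pos[ã] / Z_pos[a₀]²) · Q_N(B)^{1/2}`, where `P_N, Q_N` are the local Gibbs laws
of `(a₀,u₀,θ₀)` and `(1,0,θc)` and `Z_pos[·]` the configurational partition functions at diameter
`ε_N = σ(N+1)^{-1/3}` (`σ ≤ 1/2`, so that they are positive). Proof: `P_N(B) = ∫_B Z_P⁻¹ F_P`,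
`Z_P⁻¹F_P ≤ √((Z_Q/Z_P²)F_R) √(Z_Q⁻¹ F_Q)`, Hölder `(2,2)`, `∫ F_R = Z_pos[ã]`, `∫_B Z_Q⁻¹F_Q = Q_N(B)`.
[folklore] -/
theorem localGibbsLaw_le_sqrt_mul_rpow_half {a₀ θ₀ aR θR : T3 → ℝ} {u₀ uR : T3 → V3} {θc : ℝ}
    (ha : Continuous a₀) (hθ : Continuous θ₀) (hu : Continuous u₀) (ha0 : ∀ x, 0 < a₀ x)
    (hθ0 : ∀ x, 0 < θ₀ x) (haR : Continuous aR) (hθR : Continuous θR) (huR : Continuous uR)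
    (haR0 : ∀ x, 0 ≤ aR x) (hθR0 : ∀ x, 0 < θR x) (hθc : 0 < θc)
    (hdom : ∀ y, localGibbsProfile a₀ u₀ θ₀ y ^ 2 ≤
      localGibbsProfile aR uR θR y * localGibbsProfile 1 0 (fun _ => θc) y)
    {σ : ℝ} (hσ : σ ≤ 1 / 2) (N : ℕ)
    (Φ : HardSphereFlow (Torus.geometry (Fin 3)) (hsDiameter σ N) (N + 1))
    {B : Set (Config (N + 1) (Fin 3) T3)} (hB : MeasurableSet B) :
    localGibbsLaw σ a₀ u₀ θ₀ N Φ B ≤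
      ENNReal.ofReal (Real.sqrt (posPartition 1 (hsDiameter σ N) (N + 1) *
          posPartition aR (hsDiameter σ N) (N + 1) / posPartition a₀ (hsDiameter σ N) (N + 1) ^ 2)) *
        (localGibbsLaw σ 1 0 (fun _ => θc) N Φ B) ^ (1 / 2 : ℝ) := by
  set ε := hsDiameter σ N with hε
  set D := hardSphereDomain (Torus.geometry (Fin 3)) (N + 1) ε with hD
  set FP := D.indicator (tensorPow (N + 1) (localGibbsProfile a₀ u₀ θ₀)) with hFP
  set FR := D.indicator (tensorPow (N + 1) (localGibbsProfile aR uR θR)) with hFR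
  set FQ := D.indicator (tensorPow (N + 1) (localGibbsProfile (1 : T3 → ℝ) (0 : T3 → V3)
    (fun _ => θc))) with hFQ
  set ZP := posPartition a₀ ε (N + 1) with hZP
  set ZR := posPartition aR ε (N + 1) with hZR
  set ZQ := posPartition (1 : T3 → ℝ) ε (N + 1) with hZQ
  have ha0' : ∀ x, 0 ≤ a₀ x := fun x => (ha0 x).le
  have hZPpos : 0 < ZP := posPartition_pos ha ha0 hσ N
  have hZQpos : 0 < ZQ := posPartition_pos continuous_one (fun _ => one_pos) hσ N
  have hZR0 : 0 ≤ ZR := posPartition_nonneg haR0 _ _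
  have hcP : canonicalPartition (Torus.geometry (Fin 3)) ε (N + 1) (localGibbsProfile a₀ u₀ θ₀) =
      ZP := canonicalPartition_eq_posPartition ha hθ hu ha0' hθ0 _ _
  have hcQ : canonicalPartition (Torus.geometry (Fin 3)) ε (N + 1)
      (localGibbsProfile (1 : T3 → ℝ) (0 : T3 → V3) (fun _ => θc)) = ZQ :=
    canonicalPartition_eq_posPartition continuous_one continuous_const continuous_zero
      (fun _ => zero_le_one) (fun _ => hθc) _ _
  -- nonnegativity and measurability of the three weights
  have hFP0 : ∀ z, 0 ≤ FP z := fun z => Set.indicator_nonneg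
    (fun w _ => tensorPow_nonneg (localGibbsProfile_nonneg ha0' fun x => (hθ0 x).le) _ w) z
  have hFR0 : ∀ z, 0 ≤ FR z := fun z => Set.indicator_nonneg
    (fun w _ => tensorPow_nonneg (localGibbsProfile_nonneg haR0 fun x => (hθR0 x).le) _ w) z
  have hFQ0 : ∀ z, 0 ≤ FQ z := fun z => Set.indicator_nonneg
    (fun w _ => tensorPow_nonneg (localGibbsProfile_nonneg (fun _ => zero_le_one)
      fun _ => hθc.le) _ w) z
  have hFRm : Measurable FR := measurable_indicator_tensorPow haR hθR huR ε (N + 1)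
  have hFQm : Measurable FQ :=
    measurable_indicator_tensorPow continuous_one continuous_const continuous_zero ε (N + 1)
  -- the two Cauchy–Schwarz factors
  set g : Config (N + 1) (Fin 3) T3 → ℝ≥0∞ :=
    fun z => ENNReal.ofReal (Real.sqrt (ZQ / ZP ^ 2 * FR z)) with hg
  set h : Config (N + 1) (Fin 3) T3 → ℝ≥0∞ :=
    fun z => ENNReal.ofReal (Real.sqrt (ZQ⁻¹ * FQ z)) with hh
  have hgm : Measurable g :=
    (Real.continuous_sqrt.measurable.comp (measurable_const.mul hFRm)).ennreal_ofReal
  have hhm : Measurable h :=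
    (Real.continuous_sqrt.measurable.comp (measurable_const.mul hFQm)).ennreal_ofReal
  have hpt : ∀ z, ENNReal.ofReal (ZP⁻¹ * FP z) ≤ (g * h) z := by
    intro z
    simp only [hg, hh, Pi.mul_apply]
    rw [← ENNReal.ofReal_mul (Real.sqrt_nonneg _)]
    exact ENNReal.ofReal_le_ofReal (inv_mul_le_sqrt_mul_sqrt (hFP0 z) (hFQ0 z) (hFR0 z) hZPpos
      hZQpos (indicator_tensorPow_sq_le_mul hdom D z))
  have hg2 : ∀ z, g z ^ (2 : ℝ) = ENNReal.ofReal (ZQ / ZP ^ 2) * ENNReal.ofReal (FR z) := by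
    intro z
    simp only [hg]
    rw [ENNReal.rpow_two, ← ENNReal.ofReal_pow (Real.sqrt_nonneg _), Real.sq_sqrt (by
      have := hFR0 z; positivity), ENNReal.ofReal_mul (by positivity)]
  have hh2 : ∀ z, h z ^ (2 : ℝ) = ENNReal.ofReal (ZQ⁻¹ * FQ z) := by
    intro z
    simp only [hh]
    rw [ENNReal.rpow_two, ← ENNReal.ofReal_pow (Real.sqrt_nonneg _), Real.sq_sqrt (by
      have := hFQ0 z; positivity)]
  -- unfold the two laws
  rw [localGibbsLaw_eq, localGibbsLaw_eq]
  simp only [localGibbsMeasure]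
  rw [withDensity_apply _ hB, withDensity_apply _ hB]
  simp only [canonicalDensity]
  rw [hcP, hcQ]
  -- Hölder
  have hH := ENNReal.lintegral_mul_le_Lp_mul_Lq (volume.restrict B) Real.HolderConjugate.two_two
    hgm.aemeasurable hhm.aemeasurable
  simp only [hg2, hh2] at hH
  calc ∫⁻ z in B, ENNReal.ofReal (ZP⁻¹ * FP z)
      ≤ ∫⁻ z in B, (g * h) z := lintegral_mono hpt
    _ ≤ (∫⁻ z in B, ENNReal.ofReal (ZQ / ZP ^ 2) * ENNReal.ofReal (FR z)) ^ (1 / (2 : ℝ)) *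
          (∫⁻ z in B, ENNReal.ofReal (ZQ⁻¹ * FQ z)) ^ (1 / (2 : ℝ)) := hH
    _ ≤ ENNReal.ofReal (Real.sqrt (ZQ * ZR / ZP ^ 2)) *
          (∫⁻ z in B, ENNReal.ofReal (ZQ⁻¹ * FQ z)) ^ (1 / (2 : ℝ)) := by
        gcongr
        calc (∫⁻ z in B, ENNReal.ofReal (ZQ / ZP ^ 2) * ENNReal.ofReal (FR z)) ^ (1 / (2 : ℝ))
            ≤ (∫⁻ z, ENNReal.ofReal (ZQ / ZP ^ 2) * ENNReal.ofReal (FR z)) ^ (1 / (2 : ℝ)) := by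
              gcongr
              exact Measure.restrict_le_self
          _ = ENNReal.ofReal (Real.sqrt (ZQ * ZR / ZP ^ 2)) := by
              rw [lintegral_const_mul _ hFRm.ennreal_ofReal, hFR,
                lintegral_indicator_tensorPow_eq haR hθR huR haR0 hθR0 ε (N + 1), ← hZR,
                ← ENNReal.ofReal_mul (by positivity),
                ENNReal.ofReal_rpow_of_nonneg (by positivity) (by norm_num), Real.sqrt_eq_rpow]
              congr 2
              field_simp

end SmallDataRingSparsity

end Summit.AtomisticToContinuum.HydrodynamicLimit.Theorems

end
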